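import Literature.Probability.Percolation.TargetExplorationSwap
import Summits.CriticalPhenomena.PercolationContinuityZ3.Theorems.PercNearOneGluingNoHeavyLowerTailReduction
import HarnessLib

/-!
# `NoHeavyLowerTail` (stmt-CriticalPhenomena-4575), line `one-cut-osss-revealment` —
# the hub-form gluing defect through a STOPPED EXPLORATION (two-configuration swap), and where it loses

Support file for the crux `Summit.CriticalPhenomena.PercolationContinuityZ3.Theses.PercNearOneGluingNoHeavy.NoHeavyLowerTail`
(≡ `…Theses.PercNearOneGluing.NoHeavyLowerTail`, stmt-CriticalPhenomena-4575; Kozma–Nitzan arXiv:2401.12397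
Conjecture 3 in lower-tail form).  The typed open kernel of the one-cut line is the HUB FORM with a constant:
for `μ = prodBernoulli w` on `Fin n`, a relay set `A`, a hub `x ∈ A` and an observer `o`,

  `μ({o ↔ A} ∩ {o ↮ x}) ≤ C · t`   whenever all pairwise disconnections among distinct relays are `≤ t`

(`Theorems.noHeavyLowerTail_of_oneCut_const` + the hub-block Markov bound `Theorems.nhlt_hubBlockMarkov`
turn it into the crux; known: `C = O(log |A|)`, `Theorems.oneCut_logLoss`).  This file records what the
REVEALMENT route gives, as a theorem with an explicit error term, and (in this docstring) why the route
cannot remove the `log |A|` by itself.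

## The theorem (`hubDefect_le_firstRelayRevealment`)

Explore the open cluster of `o` one boundary edge at a time and STOP at the first relay
(`Literature.Probability.Percolation.TargetExploration`, Gladkov arXiv:2408.08457 Def. 2.4 / Alg. 2 with a
target set); let `S(ω)` be the revealed edges and `Z(ω) = S(ω) ∖ ω` the revealed CLOSED edges.  Gladkov's
swap lemma (Lemma 3.1, along the self-determined `S`) gives the EXACT identity
`μ({o ↔ A} ∩ {o ↮ x}) = μ⊗μ{(ω₁, ω₂) : ω₁ →_S ω₂ ∈ {o ↔ A} ∩ {o ↮ x}}`
(`TargetExploration.prodBernoulli_defect_eq_Pr2W_splice`), and on the right the splice is in the defect only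
if the first relay `a*(ω₁)` is cut from `x` in the INDEPENDENT copy `ω₂`, or some edge of `Z(ω₁)` is open in
`ω₂`.  Hence (`TargetExploration.prodBernoulli_defect_le_sum`), with `t ≥ μ(a ↮ x)` for all relays `a ≠ x`:

  `μ({o ↔ A} ∩ {o ↮ x}) ≤ t · μ(o ↔ A) + E[ 1{o ↔ A} · Σ_{e ∈ Z} w e ]`.

The first term is "the first relay found pays its own true budget" (constant ONE, no `|A|`); the price is
the expected open-weight of the closed edges the exploration had to reveal before meeting a relay.  The
version below takes the crux's pairwise hypothesis (`x ∈ A`).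

## Why this is the end of the pure revealment route (findings of the seat, 2026-08-18)

* The error term is genuinely not small: exact enumeration on all weighted `K₄, K₅` patterns (weights in
  `{0,.1,…,.95,1}`, `work/num/thmA.py` of the seat) gives instances with `E[1{hit} Σ_Z w] ≈ 0.09–0.3` while
  `t ≈ 10⁻³` (worst bound/`t` ≈ 65–95 with the max-weight-first rule, worse for other rules), although the
  bound is `≤ 2t` on 86–89% of instances.  Per revealed state the comparison "found relay dead | state"
  vs. "`t`" is false for EVERY fixed exploration rule (a relay reached only after its side cut was revealed
  closed is dead with conditional probability one) — only the SUM over states is small, and that sum is the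
  hub form itself.
* OSSS proper (variance ≤ Σ revealment × influence; O'Donnell–Saks–Schramm–Servedio 2005,
  Duminil-Copin–Raoufi–Tassion 2019) is structurally unable to give `≤ C t`: split the single cut of the
  two-blob extremiser (`Theorems/NoHeavyLowerTail/Negative/LinearFormTight.lean`) into `k` parallel edges
  of weight `c₁` with `(1 - c₁)^k = t`; each is pivotal for `{N ≥ E N/2}` with probability
  `(1 - c₁)^{k-1} ≥ t`, so every influence sum is `≥ k t` while the target is `t`.
* Decision-tree Harris/vdBK (Gladkov Thms 3.2/4.3, in the tree as `DecisionTree.PrW_mul_PrW_le_Pr2W_treeHK`,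
  `Pr2W_treeDsq_le`) with `S` = a stopped cluster exploration and FIXED monotone events reproduce exactly
  the Harris–Markov bound `t · E N` and the hub-block Markov bound — the selection of WHICH relay carries
  the cut is not a monotone event, which is the whole difficulty (cf. the max-pioneer charging / worst-first
  gluing kernels of the sibling lines, `Theorems.firstHitChargingStar`, `…WorstFirstGluing`).
* Barrier bookkeeping: the argument uses interior revealed edge sets and a second configuration, so it is
  outside the terminal-events FKG+BHK class of the internal no-go "Theorem N" (docs/m5/OVERLAP-KN-QUOTES.md)
  — but, as the error term shows, leaving that class through revealment alone does not buy the constant.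

No definitions; no named facts; trust base = the kernel.
-/

noncomputable section

namespace Summit.CriticalPhenomena.PercolationContinuityZ3.Theorems

open MeasureTheory Literature.Probability.LatticeModels Literature.Probability.Percolation
open Literature.Probability.Percolation.TargetExploration Literature.Probability.Percolation.DecisionTree
open scoped Classical BigOperators

/-- **Hub-form gluing defect through the first-relay exploration** (crux `NoHeavyLowerTail`, line
one-cut / revealment).  For bond percolation `prodBernoulli w` on `Fin n`, a relay set `A` with all pairwise
disconnection probabilities among distinct relays `≤ t` (`t ≥ 0`), a hub `x ∈ A` and any observer `o`:
`μ({o ↔ A} ∩ {o ↮ x}) ≤ t · μ(o ↔ A) + E[1{hit} · Σ_{e ∈ Z} w e]`, where the expectation is the finite sum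
over configurations `K` of `wt(K) · 1[K ∈ hit] · Σ_{e ∈ revealedClosed K} w e` for the exploration of the
cluster of `o` stopped at its first relay (`TargetExploration`).  Corollary of
`TargetExploration.prodBernoulli_defect_le_sum` (Gladkov's swap Lemma 3.1 along the revealed set). -/
theorem hubDefect_le_firstRelayRevealment (n : ℕ) (w : Sym2 (Fin n) → unitInterval) (A : Finset (Fin n))
    (o x : Fin n) (t : ℝ) (ht0 : 0 ≤ t) (hx : x ∈ A)
    (hpair : ∀ a ∈ A, ∀ a' ∈ A, a ≠ a' → (prodBernoulli w).real (openConn a a')ᶜ ≤ t) :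
    (prodBernoulli w).real ((⋃ a ∈ A, openConn o a) ∩ (openConn o x)ᶜ) ≤
      t * (prodBernoulli w).real (⋃ a ∈ A, openConn o a) +
        ∑ K ∈ (Finset.univ : Finset (Sym2 (Fin n))).powerset, wtW Finset.univ (fun e => (w e : ℝ)) K *
          ((hit Finset.univ A o).indicator (fun _ => (1 : ℝ)) K *
            ∑ e ∈ revealedClosed Finset.univ A o K, (w e : ℝ)) :=
  prodBernoulli_defect_le_sum w A o x ht0 fun a ha hax => hpair a ha x hx hax

/-- **The exact swap identity behind it**, in the crux's vocabulary: the hub-form defect probability equals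
the pair-probability that the splice `ω₁ →_S ω₂` (first configuration on the edges revealed by the stopped
exploration of `ω₁`, an independent configuration elsewhere) lies in the defect.  Any improvement of the
error term must bound this pair event better than by the revealed closed cut. -/
theorem hubDefect_eq_swap (n : ℕ) (w : Sym2 (Fin n) → unitInterval) (A : Finset (Fin n)) (o x : Fin n) :
    (prodBernoulli w).real ((⋃ a ∈ A, openConn o a) ∩ (openConn o x)ᶜ) =
      Pr2W Finset.univ (fun e => (w e : ℝ))
        {y | splice (revealedAt Finset.univ A o y.1) y.1 y.2 ∈ defect A o x} :=
  prodBernoulli_defect_eq_Pr2W_splice w A o x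

/-- The revealed-closed-cut correction of the exploration of the cluster of `o` stopped at its first
point of `A`: `E[1{hit} · Σ_{e ∈ Z} w e]` as a finite sum over configurations (`Z` = revealed CLOSED
edges).  An abbreviation-free restatement of the error term of `hubDefect_le_firstRelayRevealment`.
[folklore] -/
theorem corrSum_nonneg (n : ℕ) (w : Sym2 (Fin n) → unitInterval) (A : Finset (Fin n)) (o : Fin n) :
    0 ≤ ∑ K ∈ (Finset.univ : Finset (Sym2 (Fin n))).powerset, wtW Finset.univ (fun e => (w e : ℝ)) K *
          ((hit Finset.univ A o).indicator (fun _ => (1 : ℝ)) K *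
            ∑ e ∈ revealedClosed Finset.univ A o K, (w e : ℝ)) := by
  refine Finset.sum_nonneg fun K _ => mul_nonneg (wtW_nonneg _ (fun e => (w e).2.1) (fun e => (w e).2.2) K)
    (mul_nonneg (Set.indicator_nonneg (fun _ _ => zero_le_one) K)
      (Finset.sum_nonneg fun e _ => (w e).2.1))

/-- **The one-cut bound modulo the revealed closed cut** (shape of `stub_oneCutConst` with `C = 3`,
`ρ₀ = 1/2`, plus an error term).  With `N = |{a ∈ A : o ↔ a}|`, `E N = Σ_a μ(o ↔ a)` and `t ≥ 0` bounding
all pairwise disconnections among distinct relays, for EVERY hub `x ∈ A`: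
`μ{1 ≤ N ∧ N < E N/2} ≤ 3t + E[1{hit} · Σ_{e ∈ Z_x} w e]`, where `Z_x` is the revealed closed set of the
exploration of the cluster of `o` stopped at `A` (the error term of `hubDefect_le_firstRelayRevealment`
at the hub `x`).  On `{o ↔ x}` the hub-block Markov bound `Theorems.nhlt_hubBlockMarkov` costs `2t`; on
`{o ↮ x}` the event lies in the hub-form defect. -/
theorem oneCut_le_three_add_revealedCut (n : ℕ) (w : Sym2 (Fin n) → unitInterval) (A : Finset (Fin n))
    (o x : Fin n) (t : ℝ) (ht0 : 0 ≤ t) (hx : x ∈ A)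
    (hpair : ∀ a ∈ A, ∀ a' ∈ A, a ≠ a' → (prodBernoulli w).real (openConn a a')ᶜ ≤ t) :
    (prodBernoulli w).real {ω : BondConfig (Fin n) |
        1 ≤ (A.filter fun a => ω ∈ openConn o a).card ∧
        ((A.filter fun a => ω ∈ openConn o a).card : ℝ) <
          (∑ a ∈ A, (prodBernoulli w).real (openConn o a)) / 2} ≤
      3 * t + ∑ K ∈ (Finset.univ : Finset (Sym2 (Fin n))).powerset, wtW Finset.univ (fun e => (w e : ℝ)) K *
          ((hit Finset.univ A o).indicator (fun _ => (1 : ℝ)) K *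
            ∑ e ∈ revealedClosed Finset.univ A o K, (w e : ℝ)) := by
  set μ := prodBernoulli w with hμ
  set corr := ∑ K ∈ (Finset.univ : Finset (Sym2 (Fin n))).powerset, wtW Finset.univ (fun e => (w e : ℝ)) K *
      ((hit Finset.univ A o).indicator (fun _ => (1 : ℝ)) K *
        ∑ e ∈ revealedClosed Finset.univ A o K, (w e : ℝ)) with hcorr
  have hcard : 1 ≤ A.card := Finset.card_pos.2 ⟨x, hx⟩
  have hδ₀ : ∀ a ∈ A, μ.real (openConn a x)ᶜ ≤ t := by
    intro a ha
    by_cases hax : a = x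
    · subst hax
      have : (openConn a a : Set (BondConfig (Fin n)))ᶜ = ∅ :=
        Set.compl_empty_iff.2 (Set.eq_univ_of_forall fun ω => SimpleGraph.Reachable.refl a)
      rw [this, measureReal_empty]; exact ht0
    · exact hpair a ha x hx hax
  have hEN : (∑ a ∈ A, μ.real (openConn o a)) ≤ (A.card : ℝ) := by
    calc (∑ a ∈ A, μ.real (openConn o a)) ≤ ∑ _a ∈ A, (1 : ℝ) :=
          Finset.sum_le_sum fun a _ => measureReal_le_one
      _ = (A.card : ℝ) := by simp
  -- part 1: `{o ↮ x}` — the hub-form defect, through the stopped exploration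
  set E₁ : Set (BondConfig (Fin n)) := (⋃ a ∈ A, openConn o a) ∩ (openConn o x)ᶜ with hE₁
  have h1 : μ.real E₁ ≤ t * μ.real (⋃ a ∈ A, openConn o a) + corr :=
    hubDefect_le_firstRelayRevealment n w A o x t ht0 hx hpair
  have h1' : μ.real E₁ ≤ t + corr := by
    have : t * μ.real (⋃ a ∈ A, openConn o a) ≤ t * 1 :=
      mul_le_mul_of_nonneg_left measureReal_le_one ht0
    linarith
  -- part 2: `{o ↔ x}` — Markov for the hub block
  set E₂ : Set (BondConfig (Fin n)) := {ω | ω ∈ openConn o x ∧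
      ((A.filter fun a => ω ∈ openConn o a).card : ℝ) < (∑ a ∈ A, μ.real (openConn o a)) / 2}
    with hE₂
  have hthr : (∑ a ∈ A, μ.real (openConn o a)) / 2 < A.card := by
    have : (0 : ℝ) < A.card := by exact_mod_cast hcard
    linarith
  have h2 : μ.real E₂ ≤ 2 * t := by
    refine (nhlt_hubBlockMarkov n w A o x ((∑ a ∈ A, μ.real (openConn o a)) / 2) hthr).trans ?_
    have hnum : (∑ a ∈ A, μ.real (openConn a x)ᶜ) ≤ A.card * t := by
      calc (∑ a ∈ A, μ.real (openConn a x)ᶜ) ≤ ∑ _a ∈ A, t := Finset.sum_le_sum hδ₀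
        _ = A.card * t := by simp
    have hden : (A.card : ℝ) / 2 ≤ A.card - (∑ a ∈ A, μ.real (openConn o a)) / 2 := by linarith
    have hpos : (0 : ℝ) < A.card / 2 := by
      have : (0 : ℝ) < A.card := by exact_mod_cast hcard
      linarith
    calc (∑ a ∈ A, μ.real (openConn a x)ᶜ) / (A.card - (∑ a ∈ A, μ.real (openConn o a)) / 2)
        ≤ (A.card * t) / (A.card / 2) := div_le_div₀ (by positivity) hnum hpos hden
      _ = 2 * t := by field_simp
  -- cover and conclude
  have hcover : {ω : BondConfig (Fin n) | 1 ≤ (A.filter fun a => ω ∈ openConn o a).card ∧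
        ((A.filter fun a => ω ∈ openConn o a).card : ℝ) <
          (∑ a ∈ A, μ.real (openConn o a)) / 2} ⊆ E₁ ∪ E₂ := by
    rintro ω ⟨hN1, hN2⟩
    by_cases ho : ω ∈ openConn o x
    · exact Or.inr ⟨ho, hN2⟩
    · left
      obtain ⟨a, ha⟩ := Finset.card_pos.1 hN1
      rw [Finset.mem_filter] at ha
      exact ⟨Set.mem_iUnion₂.2 ⟨a, ha.1, ha.2⟩, ho⟩
  calc μ.real _ ≤ μ.real (E₁ ∪ E₂) := measureReal_mono hcover
    _ ≤ μ.real E₁ + μ.real E₂ := measureReal_union_le _ _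
    _ ≤ (t + corr) + 2 * t := add_le_add h1' h2
    _ = 3 * t + corr := by ring

end Summit.CriticalPhenomena.PercolationContinuityZ3.Theorems

end
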